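import Summits.QuantumFields.YangMills.Theorems.AlphaInputsT3ACv3CoreNonemptyX
import Literature.MathematicalPhysics.QuantumFieldTheory.Balaban1983to89.B8Ineq133
import HarnessLib

/-!
# `AlphaInputsT3ACv3ChargedGlueX` — STRATEGY B for 2′: THE FREE-SEAM GLUE — (D6X-CHARGED) REDUCED TO AN INNER EXACT REGULAR LIFT OF THE DATUM ON `Ω_k(h)` AND AN OUTER
# PROFILE PART ON THE `Λ_i(h)`, glued along `∂Ω_k(h)` where no v3 row and no conjunct of the seam-blind class `𝒞_X` reads — lane `pub-balaban3d`, seat alpha-2 (g4)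

WHY (this seat's STARTED line; HOME `D6L-STATUS-alpha2-g3.md` §7).  For a CHARGED datum `W` with non-trivial holonomy around a hole of `Ω_k(h)` no configuration can be regular
across `∂Ω_k(h)` AND have exact `k`-fold averages `W` on `Ω_k(h)` (Stokes), so print's [B11] Thm 1 WITH DOMAINS (whose minimiser is regular on all of `Ω₀`; its Sect. A step
(11)⇒(7) = tree leaf `B11Thm1.StepA11`, GAP G-B11-A1, needs interface-compatible data) is not a supplier of the charged row for ARBITRARY `W`; a supplier must use the free seam.
Over the seam-blind class `𝒞_X` (`…AdaptedClassX`: every conjunct reads bonds∕plaquettes INSIDE one read region `Λ_i(h)`, `i < k`, or `Ω_k(h)`, and the read bonds of ONE region are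
closed under the exact (0.4) dependency — §2 `depClosed₂_regionBondsT3`) the glue is clean: THIS FILE proves ★★ `glue_mem_adaptedClassT3X` — if `U_in` is an INNER LIFT of `W`
(`InnerLiftT3`: exact `k`-fold `blockAvg ℰp`-averages `W` on `bondsIn k Ω_k(h)`, r3's bounds on `plaqsIn s Ω_k(h)` for all `s ≤ k`, δ/2-small (0.4) loop variables at the bonds of
`Ω_k(h)` of levels `1…k`) and `U_out` an OUTER PART (`OuterPartT3`: r3 on the `Λ_i(h)`, `i < k`, the read-local (68) set, (67)-largeness, small loop variables at the bonds of the
`Λ_i(h)`), then the field `glueT3 … U_in U_out` (= `U_in` on the fine bonds with both endpoints in `Ω_k(h)`, `U_out` elsewhere) lies in `𝒞_X(k, h, W)`; hence ★★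
`adaptedClassNonemptyChargedT3X_of_innerLift`: (D6X-CHARGED) ⇐ (EL) `InnerExactLiftT3` ∧ (OP) `OuterPartsT3` — the displayed kinematic residual becomes a statement about `W` and
`Ω_k(h)` ALONE ((EL)); (OP) is W-free and is the uncharged-core construction of g2∕g3 plus r3 for the profile (successor file).  §1: two generic congruences for the lifted
ℤ³-objects (the tree's `B8Ineq133.pdevOn_congr`, `B7Prop1Local.hol_plaqWord_avgIter_congr`) and the loop-variable form of the glue lemma; §4: at an ADMISSIBLE history the boxes under the recorded
plaquettes project into `Λ_j(h)`, `j < k`, hence off `Ω_k(h)` (`agreeOn_liftCfg_glue`), so the (67)∕(68)-local conjuncts of the glue are those of `U_out`.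
HONEST FRAMING.  Kinematics∕bookkeeping; (EL) and (OP) are hypothesis schemas, NOT proved here; nothing of [B10]∕[7]∕[4]'s estimates asserted; count-neutral helper toward R3 2′
(`stub_laneRecordsV3`, items 19935∕19936); registry untouched; nothing about d = 4, the continuum, or a mass gap.

References: T. Bałaban, Commun. Math. Phys. 102 (1985) 255–275 [Balaban1985UV3] ((38)–(42) p.266, (67)–(70) p.273); CMP 98 (1985) 17–51 [Balaban1985Averaging] ((15) p.19,
p.24, p.26 locality); CMP 102 (1985) 277–309 [Balaban1985Variational] (Sect. A (11)–(13) pp.279–280); CMP 109 (1987) 249–301 [Balaban1987RG1] ((0.4) p.253).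
-/

set_option autoImplicit false

noncomputable section

/-! ## §1 (The generic congruence `pdevOn_congr` of bond configurations agreeing on a box is the tree's `B8Ineq133.pdevOn_congr`.) -/

namespace Summit.QuantumFields.YangMills.Theorems

open MeasureTheory Set
open scoped Matrix Matrix.Norms.L2Operator
open Literature.MathematicalPhysics.QuantumFieldTheory.Balaban1983to89
open Literature.MathematicalPhysics.QuantumFieldTheory.Balaban1983to89.B10 (pFun)
open Literature.MathematicalPhysics.QuantumFieldTheory.Balaban1983to89.T3ContinuumYM3Torus
open Literature.MathematicalPhysics.QuantumFieldTheory.Balaban1983to89.T3UnitLawDensityEML (ℰp)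
open Literature.MathematicalPhysics.QuantumFieldTheory.Balaban1983to89.T3UnitScaleTilt (θBal)
open Literature.MathematicalPhysics.QuantumFieldTheory.Balaban1983to89.B10Eq38TorusDomains (plaqsIn toFine toFine_zero toFine_succ)
open Literature.MathematicalPhysics.QuantumFieldTheory.Balaban1983to89.B10Eq42TorusConstraint (bondsIn lam42 lam42_self lam42_of_lt mem_bondsIn_of_mem_plaqsIn)
open Literature.MathematicalPhysics.QuantumFieldTheory.Balaban1985CMP102.Setting
open Summit.QuantumFields.Balaban3D.Carriers
open Summit.QuantumFields.Balaban3D.Proofs.Primitives (AlphaConsts)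
open Summit.QuantumFields.Balaban3D.Proofs.LiftBridge (liftCfg)
open Summit.QuantumFields.Balaban3D.Proofs.TorusLift (projSite zOf projSite_mem_plaqCover)
open Summit.QuantumFields.Balaban3D.Proofs.AdmissibleRegions (plaqCover_subset_of_admissible Omega_antitone)
open Summit.QuantumFields.Balaban3D.Proofs.Run3SmallFactors (codeZ decode_of_mem_disc)
open Summit.QuantumFields.YangMills.Theorems.BalabanUVNodesN08AlphaClassIDischarge (mem_deltaBox_of_inBox)
open Summit.QuantumFields.YangMills.Theorems.ProfileEnlarged (CollarE)
open Summit.QuantumFields.YangMills.Theorems.LocalSmallLoop (Feeds₂ DepClosed₂ loopHol_local₂ iter_blockAvg_local₂)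
open B7Prop1Explicit (hol plaqWord)
open B7Prop1Local (pdevOn loK plaqHiK InBox AgreeOn)
open B8Ineq133 (pdevOn_congr)
open B7Prop2Explicit (avgIter)

/-! ### The loop-variable form of the glue lemma -/

/-- Over an exactly dependency-closed family, configurations agreeing on `E 0` have the same (0.4) loop variables of their `i`-fold averages of record at every bond of `E (i+1)`
(`i + 1` in the standing range). [cite: Balaban1987RG1, (0.4) p.253] -/
theorem loopHol_iter_local₂ {P : Params} {G : Type*} [GaugeGroup G] (ℰ : LoopAverage G) {E : (i : ℕ) → Set (PBond P i)} (hE : DepClosed₂ E)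
    {i : ℕ} (hi : i + 1 ≤ P.m + P.K) {U U' : GaugeField P 0 G} (hUU' : ∀ b ∈ E 0, U b = U' b) {c : PBond P (i + 1)} (hc : c ∈ E (i + 1)) :
    BlockAveraging.loopHol (Averaging.iter (fun j => (BlockAveraging.blockAvg ℰ : Averaging P j G)) i U) c =
      BlockAveraging.loopHol (Averaging.iter (fun j => (BlockAveraging.blockAvg ℰ : Averaging P j G)) i U') c :=
  loopHol_local₂ hi _ _ c fun b hb => iter_blockAvg_local₂ ℰ hE i (Nat.le_of_succ_le hi) U U' hUU' b (hE i c hc b hb)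

/-! ## §2 The read bonds of ONE read region are closed under the exact dependency -/

section T3

variable (F : T3Family) (𝔠 : AlphaConsts F.L (suGroupModel 2).N) (γ : ℝ) (hγ : 0 < γ) (hγ1 : γ ≤ (min 𝔠.gamma0 1) ^ 2) (K : ℕ)

/-- **THE READ BONDS OF THE READ REGION `lam42 Ω(h) k i`** (`Λ_i(h)` for `i < k`, `Ω_k(h)` for `i = k`): its bonds of levels `s ≤ i` (empty family for `i > k`).
[cite: Balaban1985UV3, (42) p.266 + (68) p.273] -/
def AlphaInputsT3AC.regionBondsT3 (k : ℕ) (h : Hist (F.P K) k) (i : ℕ) : (s : ℕ) → Set (PBond (F.P K) s) :=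
  fun s => {b | s ≤ i ∧ i ≤ k ∧ b ∈ bondsIn s (lam42 (Omega 𝔠.lane.carrier.M₁
    (rcolOf (T3Scales F γ hγ (hγ1.trans (sq_min_one_le _ 𝔠.gamma0_pos)) K) 𝔠.lane.carrier) k h) k i)}

/-- **THE GLUED FIELD**: `U_in` on the fine bonds with both endpoints in `Ω_k(h)`, `U_out` on every other fine bond. [cite: Balaban1985Variational, Sect. A (11) p.279] -/
def AlphaInputsT3AC.glueT3 (k : ℕ) (h : Hist (F.P K) k) (U_in U_out : GaugeField (F.P K) 0 (Matrix.specialUnitaryGroup (Fin 2) ℂ)) :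
    GaugeField (F.P K) 0 (Matrix.specialUnitaryGroup (Fin 2) ℂ) :=
  fun b => by
    classical
    exact if b ∈ bondsIn 0 (Omega 𝔠.lane.carrier.M₁ (rcolOf (T3Scales F γ hγ (hγ1.trans (sq_min_one_le _ 𝔠.gamma0_pos)) K) 𝔠.lane.carrier) k h k)
      then U_in b else U_out b

variable {F 𝔠 γ hγ hγ1 K}

/-- The region families exhaust the read bonds. [folklore] -/
theorem AlphaInputsT3AC.mem_readBondsT3_iff {k : ℕ} {h : Hist (F.P K) k} {s : ℕ} {b : PBond (F.P K) s} :
    b ∈ AlphaInputsT3AC.readBondsT3 F 𝔠 γ hγ hγ1 K k h s ↔ ∃ i, b ∈ AlphaInputsT3AC.regionBondsT3 F 𝔠 γ hγ hγ1 K k h i s :=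
  ⟨fun ⟨i, h1, h2, h3⟩ => ⟨i, h1, h2, h3⟩, fun ⟨i, h1, h2, h3⟩ => ⟨i, h1, h2, h3⟩⟩

/-- **★ THE READ BONDS OF ONE READ REGION ARE CLOSED UNDER THE EXACT (0.4) DEPENDENCY** (`k ≤ K`; block saturation of the region, `…AdaptedClassX` §1). [cite: Balaban1985Averaging, p.24] -/
theorem AlphaInputsT3AC.depClosed₂_regionBondsT3 {k : ℕ} (hk : k ≤ K) (h : Hist (F.P K) k) (i : ℕ) :
    DepClosed₂ (AlphaInputsT3AC.regionBondsT3 F 𝔠 γ hγ hγ1 K k h i) := by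
  intro s c hc b hb
  obtain ⟨hsi, hik, hc⟩ := hc
  have hs1 : s + 1 ≤ (F.P K).m + (F.P K).K := (hsi.trans hik).trans (AlphaInputsT3AC.le_standing_of_le hk)
  have hs0 : s ≤ (F.P K).m + (F.P K).K := (Nat.le_succ s).trans hs1
  have key : ∀ (z : Site (F.P K) s) (y : Site (F.P K) (s + 1)), blockOf z = y →
      coarsen (s + 1) (toFine s z) = coarsen (s + 1) (toFine (s + 1) y) := by
    intro z y hzy
    rw [coarsen_succ, coarsen_toFine s hs0, hzy, coarsen_toFine (s + 1) hs1]
  have mem_of : ∀ (z : Site (F.P K) s), (blockOf z = c.src ∨ blockOf z = c.tgt) →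
      toFine s z ∈ lam42 (Omega 𝔠.lane.carrier.M₁ (rcolOf (T3Scales F γ hγ (hγ1.trans (sq_min_one_le _ 𝔠.gamma0_pos)) K) 𝔠.lane.carrier) k h) k i := by
    intro z hz
    rcases hz with hz | hz
    · exact (mem_lam42_iff_of_coarsen_eq _ _ h hsi hik (key z c.src hz)).mpr hc.1
    · exact (mem_lam42_iff_of_coarsen_eq _ _ h hsi hik (key z c.tgt hz)).mpr hc.2
  exact ⟨(Nat.le_succ s).trans hsi, hik, mem_of b.src hb.1, mem_of b.tgt hb.2⟩

/-- **★ THE GLUE LEMMA PER READ REGION**: two finest-lattice configurations that agree on the FINE bonds of the read region `lam42 Ω(h) k i` (`i ≤ k ≤ K`) have the same `s`-fold averages of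
record at every level-`s` bond of that region, `s ≤ i`. [cite: Balaban1985Averaging, p.24] -/
theorem AlphaInputsT3AC.iter_eq_of_eqOn_region {k : ℕ} (hk : k ≤ K) (h : Hist (F.P K) k) {i : ℕ} (hi : i ≤ k)
    {U U' : GaugeField (F.P K) 0 (Matrix.specialUnitaryGroup (Fin 2) ℂ)}
    (hUU' : ∀ b : PBond (F.P K) 0, b ∈ bondsIn 0 (lam42 (Omega 𝔠.lane.carrier.M₁
      (rcolOf (T3Scales F γ hγ (hγ1.trans (sq_min_one_le _ 𝔠.gamma0_pos)) K) 𝔠.lane.carrier) k h) k i) → U b = U' b)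
    {s : ℕ} (hs : s ≤ i) {c : PBond (F.P K) s}
    (hc : c ∈ bondsIn s (lam42 (Omega 𝔠.lane.carrier.M₁ (rcolOf (T3Scales F γ hγ (hγ1.trans (sq_min_one_le _ 𝔠.gamma0_pos)) K) 𝔠.lane.carrier) k h) k i)) :
    Averaging.iter (fun j => (BlockAveraging.blockAvg ℰp : Averaging (F.P K) j _)) s U c =
      Averaging.iter (fun j => (BlockAveraging.blockAvg ℰp : Averaging (F.P K) j _)) s U' c :=
  iter_blockAvg_local₂ ℰp (AlphaInputsT3AC.depClosed₂_regionBondsT3 (𝔠 := 𝔠) (hγ := hγ) (hγ1 := hγ1) hk h i) s ((hs.trans hi).trans (AlphaInputsT3AC.le_standing_of_le hk)) U U'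
    (fun b hb => hUU' b hb.2.2) c ⟨hs, hi, hc⟩

/-- The loop-variable form of the per-region glue lemma (`i' + 1 ≤ i ≤ k ≤ K`). [cite: Balaban1987RG1, (0.4) p.253] -/
theorem AlphaInputsT3AC.loopHol_iter_eq_of_eqOn_region {k : ℕ} (hk : k ≤ K) (h : Hist (F.P K) k) {i : ℕ} (hi : i ≤ k)
    {U U' : GaugeField (F.P K) 0 (Matrix.specialUnitaryGroup (Fin 2) ℂ)}
    (hUU' : ∀ b : PBond (F.P K) 0, b ∈ bondsIn 0 (lam42 (Omega 𝔠.lane.carrier.M₁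
      (rcolOf (T3Scales F γ hγ (hγ1.trans (sq_min_one_le _ 𝔠.gamma0_pos)) K) 𝔠.lane.carrier) k h) k i) → U b = U' b)
    {i' : ℕ} (hi' : i' + 1 ≤ i) {c : PBond (F.P K) (i' + 1)}
    (hc : c ∈ bondsIn (i' + 1) (lam42 (Omega 𝔠.lane.carrier.M₁ (rcolOf (T3Scales F γ hγ (hγ1.trans (sq_min_one_le _ 𝔠.gamma0_pos)) K) 𝔠.lane.carrier) k h) k i))
    (x : BlockAveraging.Idx (F.P K)) :
    BlockAveraging.loopHol (Averaging.iter (fun j => (BlockAveraging.blockAvg ℰp : Averaging (F.P K) j _)) i' U) c x =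
      BlockAveraging.loopHol (Averaging.iter (fun j => (BlockAveraging.blockAvg ℰp : Averaging (F.P K) j _)) i' U') c x :=
  congrFun (loopHol_iter_local₂ ℰp (AlphaInputsT3AC.depClosed₂_regionBondsT3 (𝔠 := 𝔠) (hγ := hγ) (hγ1 := hγ1) hk h i) ((hi'.trans hi).trans (AlphaInputsT3AC.le_standing_of_le hk))
    (fun b hb => hUU' b hb.2.2) ⟨hi', hi, hc⟩) x

/-- The plaquette form of the per-region glue lemma: at a plaquette with all corners in the region the `s`-fold averaged plaquette variables agree. [cite: Balaban1985UV3, (68) p.273] -/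
theorem AlphaInputsT3AC.plaqHol_iter_eq_of_eqOn_region {k : ℕ} (hk : k ≤ K) (h : Hist (F.P K) k) {i : ℕ} (hi : i ≤ k)
    {U U' : GaugeField (F.P K) 0 (Matrix.specialUnitaryGroup (Fin 2) ℂ)}
    (hUU' : ∀ b : PBond (F.P K) 0, b ∈ bondsIn 0 (lam42 (Omega 𝔠.lane.carrier.M₁
      (rcolOf (T3Scales F γ hγ (hγ1.trans (sq_min_one_le _ 𝔠.gamma0_pos)) K) 𝔠.lane.carrier) k h) k i) → U b = U' b)
    {s : ℕ} (hs : s ≤ i) {q : Plaq (F.P K) s}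
    (hq : q ∈ plaqsIn s (lam42 (Omega 𝔠.lane.carrier.M₁ (rcolOf (T3Scales F γ hγ (hγ1.trans (sq_min_one_le _ 𝔠.gamma0_pos)) K) 𝔠.lane.carrier) k h) k i)) :
    GaugeField.plaqHol (Averaging.iter (fun j => (BlockAveraging.blockAvg ℰp : Averaging (F.P K) j _)) s U) q =
      GaugeField.plaqHol (Averaging.iter (fun j => (BlockAveraging.blockAvg ℰp : Averaging (F.P K) j _)) s U') q := by
  obtain ⟨h₁, h₂, h₃, h₄⟩ := mem_bondsIn_of_mem_plaqsIn hq
  unfold GaugeField.plaqHol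
  rw [AlphaInputsT3AC.iter_eq_of_eqOn_region (hγ1 := hγ1) hk h hi hUU' hs h₁, AlphaInputsT3AC.iter_eq_of_eqOn_region (hγ1 := hγ1) hk h hi hUU' hs h₂,
    AlphaInputsT3AC.iter_eq_of_eqOn_region (hγ1 := hγ1) hk h hi hUU' hs h₃, AlphaInputsT3AC.iter_eq_of_eqOn_region (hγ1 := hγ1) hk h hi hUU' hs h₄]

/-! ## §3 The glued field agrees with `U_in` on the fine bonds of `Ω_k(h)` and with `U_out` on those of every `Λ_i(h)`, `i < k` -/

/-- On the fine bonds of `Ω_k(h)` the glue is `U_in`. [folklore] -/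
theorem AlphaInputsT3AC.glueT3_eq_in {k : ℕ} {h : Hist (F.P K) k} (U_in U_out : GaugeField (F.P K) 0 (Matrix.specialUnitaryGroup (Fin 2) ℂ))
    {b : PBond (F.P K) 0} (hb : b ∈ bondsIn 0 (lam42 (Omega 𝔠.lane.carrier.M₁
      (rcolOf (T3Scales F γ hγ (hγ1.trans (sq_min_one_le _ 𝔠.gamma0_pos)) K) 𝔠.lane.carrier) k h) k k)) :
    AlphaInputsT3AC.glueT3 F 𝔠 γ hγ hγ1 K k h U_in U_out b = U_in b := by
  classical
  rw [lam42_self] at hb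
  unfold AlphaInputsT3AC.glueT3
  exact if_pos hb

/-- Off `Ω_k(h)` (source not in `Ω_k(h)`) the glue is `U_out`. [folklore] -/
theorem AlphaInputsT3AC.glueT3_eq_out_of_not_mem {k : ℕ} {h : Hist (F.P K) k} (U_in U_out : GaugeField (F.P K) 0 (Matrix.specialUnitaryGroup (Fin 2) ℂ))
    {b : PBond (F.P K) 0} (hb : toFine 0 b.src ∉ Omega 𝔠.lane.carrier.M₁
      (rcolOf (T3Scales F γ hγ (hγ1.trans (sq_min_one_le _ 𝔠.gamma0_pos)) K) 𝔠.lane.carrier) k h k) :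
    AlphaInputsT3AC.glueT3 F 𝔠 γ hγ hγ1 K k h U_in U_out b = U_out b := by
  classical
  unfold AlphaInputsT3AC.glueT3
  exact if_neg fun hb' => hb hb'.1

/-- On the fine bonds of `Λ_i(h)`, `i < k`, the glue is `U_out` (`Λ_i(h) ∩ Ω_k(h) = ∅`: `Ω_k ⊆ Ω_{i+1}`). [folklore] -/
theorem AlphaInputsT3AC.glueT3_eq_out {k : ℕ} {h : Hist (F.P K) k} (U_in U_out : GaugeField (F.P K) 0 (Matrix.specialUnitaryGroup (Fin 2) ℂ))
    {i : ℕ} (hik : i < k) {b : PBond (F.P K) 0} (hb : b ∈ bondsIn 0 (lam42 (Omega 𝔠.lane.carrier.M₁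
      (rcolOf (T3Scales F γ hγ (hγ1.trans (sq_min_one_le _ 𝔠.gamma0_pos)) K) 𝔠.lane.carrier) k h) k i)) :
    AlphaInputsT3AC.glueT3 F 𝔠 γ hγ hγ1 K k h U_in U_out b = U_out b := by
  refine AlphaInputsT3AC.glueT3_eq_out_of_not_mem (hγ1 := hγ1) U_in U_out fun hmem => ?_
  rw [lam42_of_lt hik] at hb
  exact hb.1.2 (Omega_antitone 𝔠.lane.carrier.M₁ _ k h (i + 1) k hik le_rfl hmem)

/-! ## §4 At an admissible history the lifted objects at the recorded plaquettes read the glue through `U_out` -/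

/-- **THE BOX UNDER A RECORDED PLAQUETTE PROJECTS OFF `Ω_k(h)`**: at an ADMISSIBLE history, for `e = (j, p′) ∈ disc h` the lifts of the glue and of `U_out` agree on the box
`[L^j z, L^j z + (L^j − 1)𝟙 + L^j e_μ + L^j e_ν]` under `p′` (its sites project into `plaqCover p′ ⊆ Λ_j(h)`, disjoint from `Ω_k(h) ⊆ Ω_{j+1}(h)`). [cite: Balaban1985UV3, (69)–(70) p.273] -/
theorem AlphaInputsT3AC.agreeOn_liftCfg_glue {k : ℕ} (hk : k ≤ K) {h : Hist (F.P K) k}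
    (hh : Hist.Admissible 𝔠.lane.carrier.M₁ (rcolOf (T3Scales F γ hγ (hγ1.trans (sq_min_one_le _ 𝔠.gamma0_pos)) K) 𝔠.lane.carrier) k h)
    (U_in U_out : GaugeField (F.P K) 0 (Matrix.specialUnitaryGroup (Fin 2) ℂ)) {e : ℕ × PlaqCode (F.P K)} (he : e ∈ Hist.disc h) :
    AgreeOn (loK F.L e.1 (codeZ e)) (plaqHiK F.L e.1 (codeZ e) e.2.2.1 e.2.2.2)
      (liftCfg (S := T3Scales F γ hγ (hγ1.trans (sq_min_one_le _ 𝔠.gamma0_pos)) K) (suGroupModel 2) (AlphaInputsT3AC.glueT3 F 𝔠 γ hγ hγ1 K k h U_in U_out))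
      (liftCfg (S := T3Scales F γ hγ (hγ1.trans (sq_min_one_le _ 𝔠.gamma0_pos)) K) (suGroupModel 2) U_out) := by
  set S : Scales F.L := T3Scales F γ hγ (hγ1.trans (sq_min_one_le _ 𝔠.gamma0_pos)) K with hS
  obtain ⟨j, hj, p, hp, hqj, hz, hμ, hν⟩ := decode_of_mem_disc (S := S) he
  have hq1 : e.1 = j := by rw [hqj]
  have hjm : j ≤ (F.P K).m + (F.P K).K := (Nat.le_of_lt hj).trans (AlphaInputsT3AC.le_standing_of_le hk)
  rw [hq1, hz, hμ, hν]
  intro x κ hx _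
  have hbox : x ∈ B10Eq70Squaring.deltaBox ((F.P K).L ^ j) (((F.P K).L ^ j) • zOf p) p.μ p.ν := mem_deltaBox_of_inBox (F.P K).L j (zOf p) p.μ p.ν hx
  have hΛ := plaqCover_subset_of_admissible 𝔠.lane.carrier.M₁ (rcolOf S 𝔠.lane.carrier) hh hj hp (projSite_mem_plaqCover hjm p hbox)
  have hout : toFine 0 (projSite x) ∉ Omega 𝔠.lane.carrier.M₁ (rcolOf S 𝔠.lane.carrier) k h k :=
    fun hmem => hΛ.2 (Omega_antitone 𝔠.lane.carrier.M₁ _ k h (j + 1) k hj le_rfl hmem)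
  show (suGroupModel 2).ρ.toHomUnits (AlphaInputsT3AC.glueT3 F 𝔠 γ hγ hγ1 K k h U_in U_out ⟨projSite x, κ⟩) =
    (suGroupModel 2).ρ.toHomUnits (U_out ⟨projSite x, κ⟩)
  rw [AlphaInputsT3AC.glueT3_eq_out_of_not_mem (hγ1 := hγ1) U_in U_out hout]

/-- **THE READ-LOCAL (68) SET READS THE GLUE THROUGH `U_out`** (admissible `h`, `k ≤ K`). [cite: Balaban1985UV3, (68) p.273] -/
theorem AlphaInputsT3AC.glue_mem_reg68LocalSet {k : ℕ} (hk : k ≤ K) {h : Hist (F.P K) k}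
    (hh : Hist.Admissible 𝔠.lane.carrier.M₁ (rcolOf (T3Scales F γ hγ (hγ1.trans (sq_min_one_le _ 𝔠.gamma0_pos)) K) 𝔠.lane.carrier) k h)
    {U_in U_out : GaugeField (F.P K) 0 (Matrix.specialUnitaryGroup (Fin 2) ℂ)} (hout : U_out ∈ AlphaInputsT3AC.reg68LocalSet F 𝔠 γ hγ hγ1 K k h) :
    AlphaInputsT3AC.glueT3 F 𝔠 γ hγ hγ1 K k h U_in U_out ∈ AlphaInputsT3AC.reg68LocalSet F 𝔠 γ hγ hγ1 K k h := by
  intro e he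
  rw [pdevOn_congr (AlphaInputsT3AC.agreeOn_liftCfg_glue (hγ1 := hγ1) hk hh U_in U_out he)]
  exact hout e he

/-- **THE (67)-LARGENESS SET READS THE GLUE THROUGH `U_out`** (admissible `h`, `k ≤ K`; locality of the lifted `j`-fold average at a plaquette, `hol_plaqWord_avgIter_congr`).
[cite: Balaban1985UV3, (67) p.273; Balaban1985Averaging, p.26] -/
theorem AlphaInputsT3AC.glue_mem_large67Set {k : ℕ} (hk : k ≤ K) {h : Hist (F.P K) k}
    (hh : Hist.Admissible 𝔠.lane.carrier.M₁ (rcolOf (T3Scales F γ hγ (hγ1.trans (sq_min_one_le _ 𝔠.gamma0_pos)) K) 𝔠.lane.carrier) k h)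
    {U_in U_out : GaugeField (F.P K) 0 (Matrix.specialUnitaryGroup (Fin 2) ℂ)} (hout : U_out ∈ AlphaInputsT3AC.large67Set F 𝔠 γ hγ hγ1 K k h) :
    AlphaInputsT3AC.glueT3 F 𝔠 γ hγ hγ1 K k h U_in U_out ∈ AlphaInputsT3AC.large67Set F 𝔠 γ hγ hγ1 K k h := by
  intro e he
  have hL1 : 1 ≤ F.L := by have := F.hL.2; omega
  rw [B7Prop1Local.hol_plaqWord_avgIter_congr F.L hL1 e.1 (codeZ e) e.2.2.1 e.2.2.2 (AlphaInputsT3AC.agreeOn_liftCfg_glue (hγ1 := hγ1) hk hh U_in U_out he)]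
  exact hout e he

/-! ## §5 Inner lifts, outer parts, and the glue theorem -/

variable (F 𝔠 γ hγ hγ1 K)

/-- **AN INNER LIFT OF THE DATUM `W` ON `Ω_k(h)`** (the W-dependent half of a member of `𝒞_X`, read inside `Ω_k(h)` only): a finest-lattice field with (i) δ/2-small (0.4) loop variables of its
averages of record at the bonds of `Ω_k(h)` of levels `1, …, k`; (ii) EXACT `k`-fold `blockAvg ℰp`-averages `W` on `bondsIn k Ω_k(h)` ((42)); (iii) r3's multi-level regularity on the
plaquettes inside `Ω_k(h)`: `|((blockAvg ℰp)^s U)(∂q) − 1| ≤ C68·θ(K−k)·L^{−2(k−s)}` for `q ∈ plaqsIn s Ω_k(h)`, `s ≤ k` ((68)).  Print's model: the exact regular lift `U_k(V)` of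
[B11] Sect. A (11)–(13) restricted to `B(Λ_k)`. [cite: Balaban1985UV3, (42) p.266 + (68) p.273; Balaban1985Variational, (11)–(13) pp.279–280] -/
def AlphaInputsT3AC.InnerLiftT3 (k : ℕ) (h : Hist (F.P K) k) (W : GaugeField (F.P K) k (Matrix.specialUnitaryGroup (Fin 2) ℂ))
    (U : GaugeField (F.P K) 0 (Matrix.specialUnitaryGroup (Fin 2) ℂ)) : Prop :=
  (∀ i, i < k → ∀ c : PBond (F.P K) (i + 1), c ∈ bondsIn (i + 1) (lam42 (Omega 𝔠.lane.carrier.M₁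
      (rcolOf (T3Scales F γ hγ (hγ1.trans (sq_min_one_le _ 𝔠.gamma0_pos)) K) 𝔠.lane.carrier) k h) k k) →
    ∀ x : BlockAveraging.Idx (F.P K),
      GaugeGroup.dist1 (BlockAveraging.loopHol (Averaging.iter (fun j => (BlockAveraging.blockAvg ℰp : Averaging (F.P K) j _)) i U) c x) ≤ ℰp.δ / 2) ∧
  U ∈ AlphaInputsT3AC.top42Set F 𝔠 γ hγ hγ1 K k h W ∧
  (∀ s, s ≤ k → ∀ q : Plaq (F.P K) s, q ∈ plaqsIn s (lam42 (Omega 𝔠.lane.carrier.M₁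
      (rcolOf (T3Scales F γ hγ (hγ1.trans (sq_min_one_le _ 𝔠.gamma0_pos)) K) 𝔠.lane.carrier) k h) k k) →
    GaugeGroup.dist1 (GaugeField.plaqHol (Averaging.iter (fun l => BlockAveraging.blockAvg (P := F.P K) (j := l) ℰp) s U) q) ≤
      𝔠.C68 * θBal F.L γ 𝔠.b₀ 𝔠.p₀ (K - k) * (((F.L : ℝ) ^ (k - s))⁻¹) ^ 2)

/-- **AN OUTER PART AT `(k, h)`** (the W-independent half of a member of `𝒞_X`, read off `Ω_k(h)`): (i) δ/2-small loop variables at the bonds of the `Λ_i(h)`, `i < k`, of levels `1, …, i`;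
(ii) the read-local (68) set; (iii) (67)-largeness at the recorded plaquettes; (iv) r3 on the `Λ_i(h)`, `i < k`: `|((blockAvg ℰp)^s U)(∂q) − 1| ≤ C68·θ(K−i)·L^{−2(i−s)}` for
`q ∈ plaqsIn s Λ_i(h)`, `s ≤ i`.  The enlarged-region profile of g2∕g3 is the intended witness. [cite: Balaban1985UV3, (67)–(68) p.273] -/
def AlphaInputsT3AC.OuterPartT3 (k : ℕ) (h : Hist (F.P K) k) (U : GaugeField (F.P K) 0 (Matrix.specialUnitaryGroup (Fin 2) ℂ)) : Prop :=
  (∀ i', i' < k → ∀ i, i + 1 ≤ i' → ∀ c : PBond (F.P K) (i + 1), c ∈ bondsIn (i + 1) (lam42 (Omega 𝔠.lane.carrier.M₁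
      (rcolOf (T3Scales F γ hγ (hγ1.trans (sq_min_one_le _ 𝔠.gamma0_pos)) K) 𝔠.lane.carrier) k h) k i') →
    ∀ x : BlockAveraging.Idx (F.P K),
      GaugeGroup.dist1 (BlockAveraging.loopHol (Averaging.iter (fun j => (BlockAveraging.blockAvg ℰp : Averaging (F.P K) j _)) i U) c x) ≤ ℰp.δ / 2) ∧
  U ∈ AlphaInputsT3AC.reg68LocalSet F 𝔠 γ hγ hγ1 K k h ∧
  U ∈ AlphaInputsT3AC.large67Set F 𝔠 γ hγ hγ1 K k h ∧
  (∀ i, i < k → ∀ s, s ≤ i → ∀ q : Plaq (F.P K) s, q ∈ plaqsIn s (lam42 (Omega 𝔠.lane.carrier.M₁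
      (rcolOf (T3Scales F γ hγ (hγ1.trans (sq_min_one_le _ 𝔠.gamma0_pos)) K) 𝔠.lane.carrier) k h) k i) →
    GaugeGroup.dist1 (GaugeField.plaqHol (Averaging.iter (fun l => BlockAveraging.blockAvg (P := F.P K) (j := l) ℰp) s U) q) ≤
      𝔠.C68 * θBal F.L γ 𝔠.b₀ 𝔠.p₀ (K - i) * (((F.L : ℝ) ^ (i - s))⁻¹) ^ 2)

/-- **(EL) — INNER EXACT REGULAR LIFTS EXIST** (hypothesis schema, kinematic, never asserted; the W-DEPENDENT residual of the charged row after the free-seam glue): for every `k ≤ K`,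
every admissible non-trivial history and every CHARGED datum `W`, some finest-lattice field is an inner lift of `W` on `Ω_k(h)` (`InnerLiftT3`).  A statement about `W` and the
big-block region `Ω_k(h)` alone. [cite: Balaban1985Variational, (11)–(13) pp.279–280; Balaban1985UV3, (42) p.266 + (68) p.273] -/
def AlphaInputsT3AC.InnerExactLiftT3 (K : ℕ) : Prop :=
  ∀ (k : ℕ), k ≤ K → ∀ (h : Hist (F.P K) k),
    Hist.Admissible 𝔠.lane.carrier.M₁ (rcolOf (T3Scales F γ hγ (hγ1.trans (sq_min_one_le _ 𝔠.gamma0_pos)) K) 𝔠.lane.carrier) k h →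
    h ≠ Hist.triv (F.P K) k → ∀ (W : GaugeField (F.P K) k (Matrix.specialUnitaryGroup (Fin 2) ℂ)),
      ChargedT3 F γ 𝔠.b₀ 𝔠.p₀ (avgWindowFactor F.L) K 𝔠.lane.carrier.M₁
        (rcolOf (T3Scales F γ hγ (hγ1.trans (sq_min_one_le _ 𝔠.gamma0_pos)) K) 𝔠.lane.carrier) k h W →
      ∃ U : GaugeField (F.P K) 0 (Matrix.specialUnitaryGroup (Fin 2) ℂ), AlphaInputsT3AC.InnerLiftT3 F 𝔠 γ hγ hγ1 K k h W U

/-- **(OP) — OUTER PARTS EXIST** (hypothesis schema, W-free): at every admissible non-trivial history of the run's levels some finest-lattice field is an outer part (`OuterPartT3`).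
[cite: Balaban1985UV3, (67)–(68) p.273] -/
def AlphaInputsT3AC.OuterPartsT3 (K : ℕ) : Prop :=
  ∀ (k : ℕ), k ≤ K → ∀ (h : Hist (F.P K) k),
    Hist.Admissible 𝔠.lane.carrier.M₁ (rcolOf (T3Scales F γ hγ (hγ1.trans (sq_min_one_le _ 𝔠.gamma0_pos)) K) 𝔠.lane.carrier) k h →
    h ≠ Hist.triv (F.P K) k → ∃ U : GaugeField (F.P K) 0 (Matrix.specialUnitaryGroup (Fin 2) ℂ), AlphaInputsT3AC.OuterPartT3 F 𝔠 γ hγ hγ1 K k h U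

variable {F 𝔠 γ hγ hγ1 K}

/-- **★★ THE FREE-SEAM GLUE THEOREM**: at an admissible history (`k ≤ K`), the glue of an inner lift of `W` on `Ω_k(h)` and an outer part lies in the seam-blind adapted class
`𝒞_X(k, h, W)` — every conjunct of `𝒞_X` reads one read region, where the glue is one of the two pieces (`iter_eq_of_eqOn_region`, `agreeOn_liftCfg_glue`).
[cite: Balaban1985UV3, (42) p.266 + (67)–(68) p.273; Balaban1985Variational, (11)–(13) pp.279–280] -/
theorem AlphaInputsT3AC.glue_mem_adaptedClassT3X {k : ℕ} (hk : k ≤ K) {h : Hist (F.P K) k}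
    (hh : Hist.Admissible 𝔠.lane.carrier.M₁ (rcolOf (T3Scales F γ hγ (hγ1.trans (sq_min_one_le _ 𝔠.gamma0_pos)) K) 𝔠.lane.carrier) k h)
    {W : GaugeField (F.P K) k (Matrix.specialUnitaryGroup (Fin 2) ℂ)} {U_in U_out : GaugeField (F.P K) 0 (Matrix.specialUnitaryGroup (Fin 2) ℂ)}
    (hin : AlphaInputsT3AC.InnerLiftT3 F 𝔠 γ hγ hγ1 K k h W U_in) (hout : AlphaInputsT3AC.OuterPartT3 F 𝔠 γ hγ hγ1 K k h U_out) :
    AlphaInputsT3AC.glueT3 F 𝔠 γ hγ hγ1 K k h U_in U_out ∈ AlphaInputsT3AC.adaptedClassT3X F 𝔠 γ hγ hγ1 K k h W := by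
  obtain ⟨hinL, hinT, hinR⟩ := hin
  obtain ⟨houtL, hout68, hout67, houtR⟩ := hout
  set U := AlphaInputsT3AC.glueT3 F 𝔠 γ hγ hγ1 K k h U_in U_out with hU
  -- the glue agrees with `U_in` on the fine bonds of `Ω_k(h)` and with `U_out` on those of every `Λ_i(h)`, `i < k`
  have hagree_in : ∀ b : PBond (F.P K) 0, b ∈ bondsIn 0 (lam42 (Omega 𝔠.lane.carrier.M₁
      (rcolOf (T3Scales F γ hγ (hγ1.trans (sq_min_one_le _ 𝔠.gamma0_pos)) K) 𝔠.lane.carrier) k h) k k) → U b = U_in b :=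
    fun b hb => AlphaInputsT3AC.glueT3_eq_in (hγ1 := hγ1) U_in U_out hb
  have hagree_out : ∀ i, i < k → ∀ b : PBond (F.P K) 0, b ∈ bondsIn 0 (lam42 (Omega 𝔠.lane.carrier.M₁
      (rcolOf (T3Scales F γ hγ (hγ1.trans (sq_min_one_le _ 𝔠.gamma0_pos)) K) 𝔠.lane.carrier) k h) k i) → U b = U_out b :=
    fun i hi b hb => AlphaInputsT3AC.glueT3_eq_out (hγ1 := hγ1) U_in U_out hi hb
  refine ⟨?_, AlphaInputsT3AC.glue_mem_reg68LocalSet (hγ1 := hγ1) hk hh hout68, AlphaInputsT3AC.glue_mem_large67Set (hγ1 := hγ1) hk hh hout67, fun hc => ⟨?_, ?_⟩⟩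
  · -- loop variables at the read bonds
    intro i hi c hc x
    obtain ⟨i', hii', hi'k, hc⟩ := hc
    rcases Nat.lt_or_ge i' k with hlt | hge
    · rw [AlphaInputsT3AC.loopHol_iter_eq_of_eqOn_region (hγ1 := hγ1) hk h hi'k (hagree_out i' hlt) hii' hc x]
      exact houtL i' hlt i hii' c hc x
    · have hi'k' : i' = k := le_antisymm hi'k hge
      subst hi'k'
      rw [AlphaInputsT3AC.loopHol_iter_eq_of_eqOn_region (hγ1 := hγ1) hk h le_rfl hagree_in hii' hc x]
      exact hinL i hi c hc x
  · -- (42) on the bonds of `Ω_k(h)`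
    intro b hb
    have hb' : b ∈ bondsIn k (lam42 (Omega 𝔠.lane.carrier.M₁
        (rcolOf (T3Scales F γ hγ (hγ1.trans (sq_min_one_le _ 𝔠.gamma0_pos)) K) 𝔠.lane.carrier) k h) k k) := by rwa [lam42_self]
    rw [AlphaInputsT3AC.iter_eq_of_eqOn_region (hγ1 := hγ1) hk h le_rfl hagree_in le_rfl hb']
    exact hinT b hb
  · -- r3
    intro i hi s hs q hq
    rcases Nat.lt_or_ge i k with hlt | hge
    · rw [AlphaInputsT3AC.plaqHol_iter_eq_of_eqOn_region (hγ1 := hγ1) hk h hi (hagree_out i hlt) hs hq]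
      exact houtR i hlt s hs q hq
    · have hik : i = k := le_antisymm hi hge
      subst hik
      rw [AlphaInputsT3AC.plaqHol_iter_eq_of_eqOn_region (hγ1 := hγ1) hk h le_rfl hagree_in hs hq]
      exact hinR s hs q hq

/-- **★★ (D6X-CHARGED) FROM INNER EXACT REGULAR LIFTS AND OUTER PARTS** — the displayed kinematic residual of 2′ over the seam-blind class REDUCED to a statement about the datum
and `Ω_k(h)` alone ((EL)) plus the W-free outer parts ((OP), the uncharged-core construction). [cite: Balaban1985UV3, (42) p.266 + (67)–(68) p.273] -/
theorem AlphaInputsT3AC.adaptedClassNonemptyChargedT3X_of_innerLift (hEL : AlphaInputsT3AC.InnerExactLiftT3 F 𝔠 γ hγ hγ1 K)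
    (hOP : AlphaInputsT3AC.OuterPartsT3 F 𝔠 γ hγ hγ1 K) : AlphaInputsT3AC.AdaptedClassNonemptyChargedT3X F 𝔠 γ hγ hγ1 K := by
  intro k hk h hh ht W hW
  obtain ⟨U_in, hin⟩ := hEL k hk h hh ht W hW
  obtain ⟨U_out, hout⟩ := hOP k hk h hh ht
  exact ⟨_, AlphaInputsT3AC.glue_mem_adaptedClassT3X (hγ1 := hγ1) hk hh hin hout⟩

/-- **(D6X) FROM (EL), (OP), THE COLLAR ROW (N2′) AND `4π ≤ C68`** (the uncharged half from `…CoreNonemptyX`). [cite: Balaban1985UV3, (40)–(42) p.266 + (67)–(68) p.273] -/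
theorem AlphaInputsT3AC.adaptedClassNonemptyT3X_of_innerLift_of_collar
    (hN2 : CollarE (T3Scales F γ hγ (hγ1.trans (sq_min_one_le _ 𝔠.gamma0_pos)) K) 𝔠 K) (hC : 4 * Real.pi ≤ 𝔠.C68)
    (hEL : AlphaInputsT3AC.InnerExactLiftT3 F 𝔠 γ hγ hγ1 K) (hOP : AlphaInputsT3AC.OuterPartsT3 F 𝔠 γ hγ hγ1 K) :
    AlphaInputsT3AC.AdaptedClassNonemptyT3X F 𝔠 γ hγ hγ1 K :=
  AlphaInputsT3AC.adaptedClassNonemptyT3X_of_charged_of_collar hN2 hC (AlphaInputsT3AC.adaptedClassNonemptyChargedT3X_of_innerLift (hγ1 := hγ1) hEL hOP)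

end T3

end Summit.QuantumFields.YangMills.Theorems

end
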